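import Summits.PneNP.PneNP.Theorems.ConvexRankGatesConvexGateBlindRankForm

set_option linter.dupNamespace false

/-!
# PneNP / ConvexRankGates — `ConvexGateBlind` is a cone-rank statement about ONE explicit matrix

Helpers (`--supports stmt-PneNP-10680`). By `convexGateBlind_iff_rankHard`
(`…RankForm.lean`) the crux `ConvexGateBlind` of route `ConvexRankGates` is equivalent to:
eventually no VALID CERTIFICATE SYSTEM for the `k`-clique-free graphs `u` of `K_m`
(`k = ⌈m^δ⌉₊`; arbitrary non-negative edge weightings `w_u` and thresholds `θ_u > w_u · u`) has its
slack matrix `[w_u · 1_Q - θ_u]_{u, Q}` against the `k`-sets `Q` factorised through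
`PSD_q × ℝ^r_{≥0}` with `q + r ≤ m^c`. This file removes the existential over `(w, θ)`: the
certificate system may be taken CANONICAL, `w_u = 1_{E ∖ u}`, `θ_u = ε`, whose slack matrix is
`D_m - εJ` with
  `D_m[u, Q] := #(E(Q) ∖ u) = ∑ₑ [e ∉ u]·[e ∈ E(Q)]`
— Hrubeš's matrix `M_f` of the monotone function `f = CLIQUE(m, k)` (rows = the maxterm side,
columns = minterms, entry = number of monotone Karchmer–Wigderson witnesses).
* `canonical_of_certificates` — ANY valid certificate system whose slack matrix factorises through
  `PSD_q × ℝ^r_{≥0}` yields, after dividing row `u` by `W_u = 1 + ∑ₑ w_u(e)` (`0 ≤ w_u ≤ W_u`) and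
  adding `2#E + 1` non-negative rank-one terms (`[e ∈ u] w_u(e)/W_u · [e ∉ Q]`,
  `[e ∉ u] (W_u - w_u(e))/W_u · [e ∈ Q]`, one constant column), a factorisation of `D_m - εJ`
  through `PSD_q × ℝ^{r'}_{≥0}`, `r' ≤ r + 2#E + 1`, for some `ε > 0`
  (`ε = min_u (θ_u - w_u · u)/W_u`). Pure algebra (`canonical_perEdge`), no duality.
* `rankHard_iff_canonicalHard`, `convexGateBlind_iff_canonical` — hence **the crux is EQUIVALENT
  to**: for some `δ ∈ (0, 1/2)` and every `c`, eventually in `m`, for every `ε > 0` the matrix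
  `D_m - εJ` has NO factorisation `tr(H_u Y_Q) + ∑_{ℓ<r} λ_{u,ℓ} s_{Q,ℓ}` with `H_u, Y_Q ⪰ 0`
  (`q × q`), `λ, s ≥ 0`, `q + r ≤ m^c`. This is Hrubeš's characterisation
  `msep(f) = min_{ε>0} rk₊(M_f - εJ) ± O(n)` (ECCC TR19-034 / 2020, Lemma 16, Thm. 20) with the
  cone enlarged from `ℝ^r_{≥0}` to `PSD_q × ℝ^r_{≥0}`, for `f = CLIQUE`, proved in full for the
  route's gate format: no circuits, wirings, gates, convex bodies or certificate systems remain —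
  the crux is the `ε`-shifted cone rank of one explicit integer matrix family, an explicit instance
  of Hrubeš's Open Problems 3–4 (psd version).
* `canonical_factorisation_eps_zero` — at `ε = 0` the same matrix factorises through `ℝ^{#E}_{≥0}`
  with no PSD part (`rk₊(M_f) ≤ n`, Hrubeš 2020, §3): the quantifier `ε > 0` is load-bearing, so
  every lower-bound argument for the crux must feel an arbitrarily small entrywise shift, and no
  entrywise-robust (continuous) rank lower bound can prove it.
[folklore: Yannakakis 1991; Gouveia–Parrilo–Thomas 2013, Thm. 1; Hrubeš 2020 (ECCC TR19-034),
Lemma 16, Thm. 20, Open Problems 3–4]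
-/

namespace Summit.PneNP.PneNP.Theorems

open Matrix Finset Filter Literature.Computability.Complexity

/-! ### From any certificate factorisation to the canonical matrix -/

/-- The per-edge identity behind `canonical_of_certificates`: for Booleans `a = [e ∈ u]`,
`b = [e ∈ Q]` and reals `W ≠ 0`, `w`:
`(1-a) b = (w b - w a)/W + (a w / W)(1 - b) + ((1-a)(W-w)/W) b`. [folklore] -/
theorem canonical_perEdge (W w : ℝ) (hW : W ≠ 0) (a b : Bool) :
    (if a then (0 : ℝ) else 1) * (if b then (1 : ℝ) else 0) =
      1 / W * (w * (if b then (1 : ℝ) else 0) - w * (if a then (1 : ℝ) else 0)) +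
        (if a then w else 0) / W * (if b then (0 : ℝ) else 1) +
        (if a then (0 : ℝ) else W - w) / W * (if b then (1 : ℝ) else 0) := by
  cases a <;> cases b <;> simp <;> field_simp <;> ring

/-- **Canonical form of a certificate factorisation.** Let the `k`-clique-free graphs `u` of `K_m`
carry non-negative edge weightings `w_u` and thresholds `θ_u` with `w_u · u < θ_u`, PSD `H_u`
(`q × q`) and `λ_u ≥ 0` (`r` entries); let the `k`-sets `Q` carry matrices `Y_Q` and `s_Q ≥ 0`; and let
the certificate slack matrix factorise, `w_u · 1_Q - θ_u = tr(H_u Y_Q) + ∑_ℓ λ_{u,ℓ} s_{Q,ℓ}`. Then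
for some `ε > 0` the CANONICAL matrix `(#(E(Q) ∖ u) - ε)_{u,Q}` factorises through
`PSD_q × ℝ^{r'}_{≥0}` with `r' ≤ r + 2#E + 1` (same `Y_Q`; `H_u/W_u`): with `W_u = 1 + ∑ₑ w_u(e)`,
`#(E(Q) ∖ u)·W_u = (w_u·Q - w_u·u) + ∑_{e ∈ u} w_u(e)[e ∉ Q] + ∑_{e ∉ u} (W_u - w_u(e))[e ∈ Q]`,
`w_u·Q - w_u·u = (w_u·Q - θ_u) + (θ_u - w_u·u)`, and `ε_u - ε ≥ 0` (`ε_u = (θ_u - w_u·u)/W_u`,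
`ε = min_u ε_u > 0`) is one constant column. [folklore; Hrubeš 2020, Lemma 16 / Thm. 20 (LP case)] -/
theorem canonical_of_certificates {m k q r : ℕ}
    (w : ((⊤ : SimpleGraph (Fin m)).edgeSet → Bool) → (⊤ : SimpleGraph (Fin m)).edgeSet → ℝ)
    (θ : ((⊤ : SimpleGraph (Fin m)).edgeSet → Bool) → ℝ)
    (H : ((⊤ : SimpleGraph (Fin m)).edgeSet → Bool) → Matrix (Fin q) (Fin q) ℝ)
    (lam : ((⊤ : SimpleGraph (Fin m)).edgeSet → Bool) → Fin r → ℝ)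
    (Y : Finset (Fin m) → Matrix (Fin q) (Fin q) ℝ) (s : Finset (Fin m) → Fin r → ℝ)
    (hw : ∀ u, cliqueFn m k u = false → ∀ e, 0 ≤ w u e)
    (hrej : ∀ u, cliqueFn m k u = false → ∑ e, w u e * (if u e then (1 : ℝ) else 0) < θ u)
    (hH : ∀ u, cliqueFn m k u = false → (H u).PosSemidef)
    (hlam : ∀ u, cliqueFn m k u = false → ∀ ℓ, 0 ≤ lam u ℓ)
    (hs : ∀ Q : Finset (Fin m), Q.card = k → ∀ ℓ, 0 ≤ s Q ℓ)
    (hfact : ∀ (Q : Finset (Fin m)) (u : (⊤ : SimpleGraph (Fin m)).edgeSet → Bool),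
      Q.card = k → cliqueFn m k u = false →
        ∑ e, w u e * (if cliqueVec Q e then (1 : ℝ) else 0) - θ u =
          (H u * Y Q).trace + ∑ ℓ, lam u ℓ * s Q ℓ) :
    ∃ ε : ℝ, 0 < ε ∧ ∃ r' : ℕ, r' ≤ r + 2 * Fintype.card ((⊤ : SimpleGraph (Fin m)).edgeSet) + 1 ∧
      ∃ (H' : ((⊤ : SimpleGraph (Fin m)).edgeSet → Bool) → Matrix (Fin q) (Fin q) ℝ)
        (lam' : ((⊤ : SimpleGraph (Fin m)).edgeSet → Bool) → Fin r' → ℝ)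
        (s' : Finset (Fin m) → Fin r' → ℝ),
        (∀ u, cliqueFn m k u = false → (H' u).PosSemidef) ∧
        (∀ u, cliqueFn m k u = false → ∀ ℓ, 0 ≤ lam' u ℓ) ∧
        (∀ Q : Finset (Fin m), Q.card = k → ∀ ℓ, 0 ≤ s' Q ℓ) ∧
        ∀ (Q : Finset (Fin m)) (u : (⊤ : SimpleGraph (Fin m)).edgeSet → Bool),
          Q.card = k → cliqueFn m k u = false →
            ∑ e, (if u e then (0 : ℝ) else 1) * (if cliqueVec Q e then (1 : ℝ) else 0) - ε =
              (H' u * Y Q).trace + ∑ ℓ, lam' u ℓ * s' Q ℓ := by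
  classical
  -- row normalisers `W_u = 1 + ∑ w_u`, margins `γ_u = θ_u - w_u·u`, `ε_u = γ_u / W_u`
  set W : (((⊤ : SimpleGraph (Fin m)).edgeSet → Bool)) → ℝ := fun u => 1 + ∑ e, w u e with hWdef
  set γ : (((⊤ : SimpleGraph (Fin m)).edgeSet → Bool)) → ℝ :=
    fun u => θ u - ∑ e, w u e * (if u e then (1 : ℝ) else 0) with hγdef
  set εu : (((⊤ : SimpleGraph (Fin m)).edgeSet → Bool)) → ℝ := fun u => γ u / W u with hεudef
  have hWpos : ∀ u, cliqueFn m k u = false → 0 < W u := fun u hu =>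
    add_pos_of_pos_of_nonneg one_pos (Finset.sum_nonneg fun e _ => hw u hu e)
  have hwle : ∀ u, cliqueFn m k u = false → ∀ e, w u e ≤ W u := fun u hu e =>
    le_add_of_nonneg_of_le zero_le_one
      (Finset.single_le_sum (f := fun e => w u e) (fun e _ => hw u hu e) (mem_univ e))
  have hεupos : ∀ u, cliqueFn m k u = false → 0 < εu u := fun u hu =>
    div_pos (sub_pos.2 (hrej u hu)) (hWpos u hu)
  -- the common margin `ε = min_u ε_u`
  set f : (((⊤ : SimpleGraph (Fin m)).edgeSet → Bool)) → ℝ :=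
    fun u => if cliqueFn m k u = false then εu u else 1 with hfdef
  have hne : (Finset.univ : Finset ((⊤ : SimpleGraph (Fin m)).edgeSet → Bool)).Nonempty :=
    Finset.univ_nonempty
  set ε : ℝ := Finset.univ.inf' hne f with hεdef
  have hεpos : 0 < ε := by
    rw [hεdef, Finset.lt_inf'_iff]
    intro u _
    simp only [hfdef]
    split_ifs with hu
    · exact hεupos u hu
    · exact one_pos
  have hεle : ∀ u, cliqueFn m k u = false → ε ≤ εu u := by
    intro u hu
    have hfu : f u = εu u := by simp [hfdef, hu]
    exact (Finset.inf'_le f (Finset.mem_univ u)).trans hfu.le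
  -- the new factors, indexed by `L = (Fin r ⊕ Unit) ⊕ (E ⊕ E)`, then enumerated
  let L := (Fin r ⊕ Unit) ⊕ (((⊤ : SimpleGraph (Fin m)).edgeSet) ⊕ ((⊤ : SimpleGraph (Fin m)).edgeSet))
  let lamL : (((⊤ : SimpleGraph (Fin m)).edgeSet → Bool)) → L → ℝ := fun u =>
    Sum.elim (Sum.elim (fun ℓ => lam u ℓ / W u) (fun _ => εu u - ε))
      (Sum.elim (fun e => (if u e then w u e else 0) / W u)
        (fun e => (if u e then (0 : ℝ) else W u - w u e) / W u))
  let sL : Finset (Fin m) → L → ℝ := fun Q =>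
    Sum.elim (Sum.elim (fun ℓ => s Q ℓ) (fun _ => 1))
      (Sum.elim (fun e => if cliqueVec Q e then (0 : ℝ) else 1)
        (fun e => if cliqueVec Q e then (1 : ℝ) else 0))
  set eL := Fintype.equivFin L with heL
  have hcardL : Fintype.card L = r + 1 + (Fintype.card ((⊤ : SimpleGraph (Fin m)).edgeSet) +
      Fintype.card ((⊤ : SimpleGraph (Fin m)).edgeSet)) := by
    simp only [L, Fintype.card_sum, Fintype.card_fin, Fintype.card_unit]
  -- row side non-negative
  have hrow : ∀ u, cliqueFn m k u = false → ∀ i : Fin (Fintype.card L), 0 ≤ lamL u (eL.symm i) := by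
    intro u hu i
    have hW0 : 0 ≤ W u := (hWpos u hu).le
    generalize eL.symm i = l
    rcases l with ((ℓ | _) | (e | e)) <;> simp only [lamL, Sum.elim_inl, Sum.elim_inr]
    · exact div_nonneg (hlam u hu ℓ) hW0
    · exact sub_nonneg.2 (hεle u hu)
    · refine div_nonneg ?_ hW0
      split_ifs
      · exact hw u hu e
      · exact le_rfl
    · refine div_nonneg ?_ hW0
      split_ifs
      · exact le_rfl
      · exact sub_nonneg.2 (hwle u hu e)
  -- column side non-negative
  have hcol : ∀ Q : Finset (Fin m), Q.card = k → ∀ i : Fin (Fintype.card L), 0 ≤ sL Q (eL.symm i) := by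
    intro Q hQ i
    generalize eL.symm i = l
    rcases l with ((ℓ | _) | (e | e)) <;> simp only [sL, Sum.elim_inl, Sum.elim_inr]
    · exact hs Q hQ ℓ
    · exact zero_le_one
    · split_ifs
      · exact le_rfl
      · exact zero_le_one
    · split_ifs
      · exact zero_le_one
      · exact le_rfl
  refine ⟨ε, hεpos, Fintype.card L, by rw [hcardL]; omega, fun u => (1 / W u) • H u,
    fun u i => lamL u (eL.symm i), fun Q i => sL Q (eL.symm i),
    fun u hu => (hH u hu).smul (div_nonneg zero_le_one (hWpos u hu).le), hrow, hcol, ?_⟩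
  -- the identity
  intro Q u hQ hu
  have hW : W u ≠ 0 := (hWpos u hu).ne'
  have hsum : ∑ i, lamL u (eL.symm i) * sL Q (eL.symm i) = ∑ l, lamL u l * sL Q l :=
    Equiv.sum_comp eL.symm (fun l => lamL u l * sL Q l)
  rw [hsum]
  simp only [L, lamL, sL, Fintype.sum_sum_type, Sum.elim_inl, Sum.elim_inr, Fintype.sum_unique,
    Matrix.smul_mul, Matrix.trace_smul, smul_eq_mul, mul_one]
  -- the factorisation identity of the certificate system, solved for the trace term
  have hF' : (H u * Y Q).trace =
      (∑ e, w u e * (if cliqueVec Q e then (1 : ℝ) else 0) - θ u) - ∑ ℓ, lam u ℓ * s Q ℓ := by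
    linarith [hfact Q u hQ hu]
  have h1 : ∑ ℓ, lam u ℓ / W u * s Q ℓ = 1 / W u * ∑ ℓ, lam u ℓ * s Q ℓ := by
    rw [Finset.mul_sum]
    exact Finset.sum_congr rfl fun i _ => by ring
  -- the canonical entry, edge by edge
  have hL : (∑ e, (if u e then (0 : ℝ) else 1) * (if cliqueVec Q e then (1 : ℝ) else 0)) =
      1 / W u * (∑ e, w u e * (if cliqueVec Q e then (1 : ℝ) else 0) -
        ∑ e, w u e * (if u e then (1 : ℝ) else 0)) +
      ∑ e, (if u e then w u e else 0) / W u * (if cliqueVec Q e then (0 : ℝ) else 1) +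
      ∑ e, (if u e then (0 : ℝ) else W u - w u e) / W u *
        (if cliqueVec Q e then (1 : ℝ) else 0) := by
    rw [← Finset.sum_sub_distrib, Finset.mul_sum, ← Finset.sum_add_distrib,
      ← Finset.sum_add_distrib]
    exact Finset.sum_congr rfl fun e _ => canonical_perEdge (W u) (w u e) hW (u e) (cliqueVec Q e)
  rw [hL, hF', h1]
  simp only [hεudef, hγdef]
  ring

/-! ### The canonical matrix at `ε = 0` is trivial -/

/-- **`ε > 0` is load-bearing.** At `ε = 0` the canonical matrix factorises through `ℝ^{#E}_{≥0}`
with NO PSD part: `#(E(Q) ∖ u) = ∑ₑ [e ∉ u] · [e ∈ Q]` (Hrubeš's remark `rk₊(M_f) ≤ n`). So the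
right-hand side of `convexGateBlind_iff_canonical` would be FALSE with `ε = 0` allowed (at `c = 2`,
`m ≥ 2`), and every lower-bound argument for the crux must exploit the shift `ε > 0`.
[folklore; Hrubeš 2020, §3] -/
theorem canonical_factorisation_eps_zero (m : ℕ) :
    ∃ (lam : ((⊤ : SimpleGraph (Fin m)).edgeSet → Bool) →
        Fin (Fintype.card ((⊤ : SimpleGraph (Fin m)).edgeSet)) → ℝ)
      (s : Finset (Fin m) → Fin (Fintype.card ((⊤ : SimpleGraph (Fin m)).edgeSet)) → ℝ),
      (∀ u ℓ, 0 ≤ lam u ℓ) ∧ (∀ Q ℓ, 0 ≤ s Q ℓ) ∧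
      ∀ (Q : Finset (Fin m)) (u : (⊤ : SimpleGraph (Fin m)).edgeSet → Bool),
        ∑ e, (if u e then (0 : ℝ) else 1) * (if cliqueVec Q e then (1 : ℝ) else 0) - 0 =
          ((0 : Matrix (Fin 0) (Fin 0) ℝ) * (0 : Matrix (Fin 0) (Fin 0) ℝ)).trace +
            ∑ ℓ, lam u ℓ * s Q ℓ := by
  classical
  set eE := Fintype.equivFin ((⊤ : SimpleGraph (Fin m)).edgeSet) with heE
  refine ⟨fun u j => if u (eE.symm j) then (0 : ℝ) else 1,
    fun Q j => if cliqueVec Q (eE.symm j) then (1 : ℝ) else 0, fun u j => ?_, fun Q j => ?_,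
    fun Q u => ?_⟩
  · positivity
  · positivity
  · rw [sub_zero, Matrix.mul_zero, Matrix.trace_zero, zero_add]
    exact (Equiv.sum_comp eE.symm
      (fun e => (if u e then (0 : ℝ) else 1) * (if cliqueVec Q e then (1 : ℝ) else 0))).symm

/-! ### The crux in canonical form -/

/-- Size bookkeeping: `q + r' ≤ m^(c+4)` for `m ≥ 2`, `n ≤ m²`, `q + r ≤ m^c`, `r' ≤ r + 2n + 1`.
[folklore] -/
theorem canonical_rank_bound {m c n q r r' : ℕ} (hm : 2 ≤ m) (hn : n ≤ m ^ 2)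
    (hqr : q + r ≤ m ^ c) (hr : r' ≤ r + 2 * n + 1) : q + r' ≤ m ^ (c + 4) := by
  have h1 : 1 ≤ m := by omega
  have hP2 : m ^ 2 ≤ m ^ (c + 2) := Nat.pow_le_pow_right h1 (by omega)
  have hPc : m ^ c ≤ m ^ (c + 2) := Nat.pow_le_pow_right h1 (by omega)
  have h4 : 4 ≤ m ^ 2 := by
    calc 4 = 2 ^ 2 := by norm_num
      _ ≤ m ^ 2 := Nat.pow_le_pow_left hm 2
  calc q + r' ≤ 4 * m ^ (c + 2) := by omega
    _ ≤ m ^ 2 * m ^ (c + 2) := Nat.mul_le_mul_right _ h4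
    _ = m ^ (c + 4) := by ring

/-- **Certificate systems may be taken canonical.** The matrix form of the crux
(`convexGateBlind_iff_rankHard`: eventually no valid certificate system `(w_u ≥ 0, θ_u > w_u·u)`
has a `PSD_q × ℝ^r_{≥0}` factorisation of its slack matrix with `q + r ≤ m^c`) is EQUIVALENT to the
same statement for the single canonical system `w_u = 1_{E ∖ u}`, `θ_u = ε`, quantified over all
`ε > 0` — i.e. to "`∀ ε > 0`, `(#(E(Q) ∖ u) - ε)_{u,Q}` has no such factorisation". (`→`: the
canonical system is a valid certificate system; `←`: `canonical_of_certificates`, the size growing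
from `m^c` to `≤ m^(c+4)` by `canonical_rank_bound`.) [folklore; Hrubeš 2020, Thm. 20] -/
theorem rankHard_iff_canonicalHard :
    (∃ δ : ℝ, 0 < δ ∧ δ < 1 / 2 ∧ ∀ c : ℕ, ∀ᶠ m : ℕ in Filter.atTop,
      ∀ (q r : ℕ), q + r ≤ m ^ c →
        ∀ (w : ((⊤ : SimpleGraph (Fin m)).edgeSet → Bool) → (⊤ : SimpleGraph (Fin m)).edgeSet → ℝ)
          (θ : ((⊤ : SimpleGraph (Fin m)).edgeSet → Bool) → ℝ)
          (H : ((⊤ : SimpleGraph (Fin m)).edgeSet → Bool) → Matrix (Fin q) (Fin q) ℝ)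
          (lam : ((⊤ : SimpleGraph (Fin m)).edgeSet → Bool) → Fin r → ℝ)
          (Y : Finset (Fin m) → Matrix (Fin q) (Fin q) ℝ) (s : Finset (Fin m) → Fin r → ℝ),
          (∀ u, cliqueFn m ⌈(m : ℝ) ^ δ⌉₊ u = false → ∀ e, 0 ≤ w u e) →
          (∀ u, cliqueFn m ⌈(m : ℝ) ^ δ⌉₊ u = false →
            ∑ e, w u e * (if u e then (1 : ℝ) else 0) < θ u) →
          (∀ u, cliqueFn m ⌈(m : ℝ) ^ δ⌉₊ u = false → (H u).PosSemidef) →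
          (∀ u, cliqueFn m ⌈(m : ℝ) ^ δ⌉₊ u = false → ∀ ℓ, 0 ≤ lam u ℓ) →
          (∀ Q : Finset (Fin m), Q.card = ⌈(m : ℝ) ^ δ⌉₊ → (Y Q).PosSemidef) →
          (∀ Q : Finset (Fin m), Q.card = ⌈(m : ℝ) ^ δ⌉₊ → ∀ ℓ, 0 ≤ s Q ℓ) →
          ¬ ∀ (Q : Finset (Fin m)) (u : (⊤ : SimpleGraph (Fin m)).edgeSet → Bool),
              Q.card = ⌈(m : ℝ) ^ δ⌉₊ → cliqueFn m ⌈(m : ℝ) ^ δ⌉₊ u = false →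
                ∑ e, w u e * (if cliqueVec Q e then (1 : ℝ) else 0) - θ u =
                  (H u * Y Q).trace + ∑ ℓ, lam u ℓ * s Q ℓ) ↔
    (∃ δ : ℝ, 0 < δ ∧ δ < 1 / 2 ∧ ∀ c : ℕ, ∀ᶠ m : ℕ in Filter.atTop, ∀ ε : ℝ, 0 < ε →
      ∀ (q r : ℕ), q + r ≤ m ^ c →
        ∀ (H : ((⊤ : SimpleGraph (Fin m)).edgeSet → Bool) → Matrix (Fin q) (Fin q) ℝ)
          (lam : ((⊤ : SimpleGraph (Fin m)).edgeSet → Bool) → Fin r → ℝ)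
          (Y : Finset (Fin m) → Matrix (Fin q) (Fin q) ℝ) (s : Finset (Fin m) → Fin r → ℝ),
          (∀ u, cliqueFn m ⌈(m : ℝ) ^ δ⌉₊ u = false → (H u).PosSemidef) →
          (∀ u, cliqueFn m ⌈(m : ℝ) ^ δ⌉₊ u = false → ∀ ℓ, 0 ≤ lam u ℓ) →
          (∀ Q : Finset (Fin m), Q.card = ⌈(m : ℝ) ^ δ⌉₊ → (Y Q).PosSemidef) →
          (∀ Q : Finset (Fin m), Q.card = ⌈(m : ℝ) ^ δ⌉₊ → ∀ ℓ, 0 ≤ s Q ℓ) →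
          ¬ ∀ (Q : Finset (Fin m)) (u : (⊤ : SimpleGraph (Fin m)).edgeSet → Bool),
              Q.card = ⌈(m : ℝ) ^ δ⌉₊ → cliqueFn m ⌈(m : ℝ) ^ δ⌉₊ u = false →
                ∑ e, (if u e then (0 : ℝ) else 1) * (if cliqueVec Q e then (1 : ℝ) else 0) - ε =
                  (H u * Y Q).trace + ∑ ℓ, lam u ℓ * s Q ℓ) := by
  constructor
  · rintro ⟨δ, hδ0, hδ1, h⟩
    refine ⟨δ, hδ0, hδ1, fun c => ?_⟩
    filter_upwards [h c] with m hm
    intro ε hε q r hqr H lam Y s hH hlam hY hs hid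
    refine hm q r hqr (fun u e => if u e then (0 : ℝ) else 1) (fun _ => ε) H lam Y s
      (fun u _ e => by positivity) (fun u _ => ?_) hH hlam hY hs (fun Q u hQ hu => hid Q u hQ hu)
    rw [Finset.sum_eq_zero fun e _ => ?_]
    · exact hε
    · cases u e <;> simp
  · rintro ⟨δ, hδ0, hδ1, h⟩
    refine ⟨δ, hδ0, hδ1, fun c => ?_⟩
    filter_upwards [h (c + 4), eventually_ge_atTop 2] with m hm h2
    intro q r hqr w θ H lam Y s hw hrej hH hlam hY hs hfact
    obtain ⟨ε, hε, r', hr', H', lam', s', hH', hlam', hs', hid⟩ :=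
      canonical_of_certificates w θ H lam Y s hw hrej hH hlam hs hfact
    exact hm ε hε q r' (canonical_rank_bound h2 (card_edgeSet_top_le m) hqr hr') H' lam' Y s'
      hH' hlam' hY hs' hid

/-- **`ConvexGateBlind` in canonical matrix form.** Crux #2 of route ConvexRankGates — no
polynomial-size `{∧₂, ∨₂} ∪ CONV_{m^c}` circuit computes `CLIQUE(m, ⌈m^δ⌉₊)` — is EQUIVALENT to the
following statement about one explicit matrix family: for some `δ ∈ (0, 1/2)` and every `c`,
eventually in `m`, for every `ε > 0`, the real matrix `(#(E(Q) ∖ u) - ε)` — rows `u` = the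
`⌈m^δ⌉₊`-clique-free graphs on `Fin m` (edge vectors), columns `Q` = the `⌈m^δ⌉₊`-subsets of `Fin m`,
`#(E(Q) ∖ u) = ∑ₑ [e ∉ u][e ∈ E(Q)]` — admits NO factorisation `tr(H_u Y_Q) + ∑_{ℓ<r} λ_{u,ℓ} s_{Q,ℓ}`
with `H_u ⪰ 0`, `Y_Q ⪰ 0` (`q × q`), `λ, s ≥ 0` and `q + r ≤ m^c`. This is Hrubeš's
`msep(f) = min_{ε>0} rk₊(M_f - εJ) ± O(n)` for the cone `PSD × ℝ^r_{≥0}` and `f = CLIQUE`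
(`convexGateBlind_iff_rankHard` ∘ `rankHard_iff_canonicalHard`); with
`canonical_factorisation_eps_zero` (rank `≤ #E` at `ε = 0`) it pins the crux to the `ε`-sensitive
cone rank of a single integer matrix. `cliqueFn` / `cliqueVec` are Literature's clique function and
clique vectors, rfl-equal to the route's inline forms. [folklore; Hrubeš 2020, Thm. 20] -/
theorem convexGateBlind_iff_canonical :
    Summit.PneNP.PneNP.Theses.ConvexRankGates.ConvexGateBlind ↔
    (∃ δ : ℝ, 0 < δ ∧ δ < 1 / 2 ∧ ∀ c : ℕ, ∀ᶠ m : ℕ in Filter.atTop, ∀ ε : ℝ, 0 < ε →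
      ∀ (q r : ℕ), q + r ≤ m ^ c →
        ∀ (H : ((⊤ : SimpleGraph (Fin m)).edgeSet → Bool) → Matrix (Fin q) (Fin q) ℝ)
          (lam : ((⊤ : SimpleGraph (Fin m)).edgeSet → Bool) → Fin r → ℝ)
          (Y : Finset (Fin m) → Matrix (Fin q) (Fin q) ℝ) (s : Finset (Fin m) → Fin r → ℝ),
          (∀ u, cliqueFn m ⌈(m : ℝ) ^ δ⌉₊ u = false → (H u).PosSemidef) →
          (∀ u, cliqueFn m ⌈(m : ℝ) ^ δ⌉₊ u = false → ∀ ℓ, 0 ≤ lam u ℓ) →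
          (∀ Q : Finset (Fin m), Q.card = ⌈(m : ℝ) ^ δ⌉₊ → (Y Q).PosSemidef) →
          (∀ Q : Finset (Fin m), Q.card = ⌈(m : ℝ) ^ δ⌉₊ → ∀ ℓ, 0 ≤ s Q ℓ) →
          ¬ ∀ (Q : Finset (Fin m)) (u : (⊤ : SimpleGraph (Fin m)).edgeSet → Bool),
              Q.card = ⌈(m : ℝ) ^ δ⌉₊ → cliqueFn m ⌈(m : ℝ) ^ δ⌉₊ u = false →
                ∑ e, (if u e then (0 : ℝ) else 1) * (if cliqueVec Q e then (1 : ℝ) else 0) - ε =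
                  (H u * Y Q).trace + ∑ ℓ, lam u ℓ * s Q ℓ) :=
  convexGateBlind_iff_rankHard.trans rankHard_iff_canonicalHard

end Summit.PneNP.PneNP.Theorems
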